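import Summits.HodgeConjecture.HodgeConjecture.Theses.HeckePrymWeil
import Summits.HodgeConjecture.HodgeConjecture.Theorems.HeckePrymWeilIsoInvariance
import Summits.HodgeConjecture.HodgeConjecture.Theorems.HeckePrymWeilHeckePrymAnchorsIsogenyTransfer
import Summits.HodgeConjecture.HodgeConjecture.Theorems.PadicSemiregularLiftHodgeAbelianVarietiesStubCmAnchoredFamilies
import Literature.AlgebraicGeometry.Motives.HyperbolicWeilType
import Literature.AlgebraicGeometry.HodgeTheory.KaehlerClass
import Literature.AlgebraicGeometry.HodgeTheory.HodgeLocus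
import Literature.AlgebraicGeometry.HodgeTheory.FermatHypersurfaceReduction
import Literature.AlgebraicGeometry.HodgeTheory.WeilClassesIsogenyDescent
import Literature.AlgebraicGeometry.HodgeTheory.HodgeConjectureQbarVoisinProofs
import HarnessLib

/-!
# Crux `WeilTenfoldsSqrtMinus11` (stmt-HodgeConjecture-1262), line `generic-ppav-secant-descent` —
# stub `stub_moduliReach` (S2, "γ ⟹ T₊"): the part provable today and the honest remainder

S2: GIVEN S1 (`stub_secantSpread`: ONE hyperbolic `K`-compatibly polarised `ℚ(√-11)`-anchor
`(A₀, ψ₀, h₀)` through which rational `(6,6)` Weil classes spread along EVERY smooth projective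
family over a smooth integral quasi-projective base), the rational `(6,6)`-classes of the Weil span
`Eig((𝟙+ψ)^*, (1+i√11)¹²) ⊔ Eig((𝟙+ψ)^*, (1-i√11)¹²)` of EVERY hyperbolic `K`-compatibly
Kähler-polarised twelvefold `(X, ψ, h)` are algebraic. Classical proof: Landherr ⟹ `X` is
`K`-isogenous to a fibre `X'` of the PEL Shimura family (neat level, connected) through `A₀`; flat
sections `hh = c₁`(relative polarisation) and `w` (rank-2 system `⋀¹²_K R¹π_*ℚ`); S1; isogeny descent.
MISSING in the tree (no declaration): the universal polarised abelian scheme with `O_K`-action over a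
neat-level PEL Shimura variety as an `IsSmoothProjectiveFamily π 12` over a smooth integral
quasi-projective `SchemeOver ℂ` (`ShimuraVarieties/` is the abstract ball-quotient layer; `FamiliesVHS`,
`HodgeLocus` give fibres and the étalé space, no moduli constructor). The only family through `A₀`
constructible today is the CONSTANT one. PROVED here (sorry-free, standard axioms):
* `map_mem_eigenspace_one_add_of_comm`, `map_mem_weilSpan_of_comm` — `K`-equivariant pull-backs
  preserve the single-operator Weil eigenspaces / span (route typing);
* `weilSpan_mem_algebraicClasses_of_spread` — **S2 ON THE ANCHOR** (constant family `A₀ ⟶ Spec ℂ`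
  instance of S1); `…_of_iso` — on every `(X, ψ)` `K`-equivariantly ISOMORPHIC to the anchor;
  `secantSpread_imp_moduliReach_isoClass` — packaged against `type_of% stub_secantSpread`;
* `stub_moduliReachGlue` — **the registered glue stub** (lead's reshape of S2, 2026-08-16): S2
  VERBATIM from S1 and the two newly REGISTERED stubs (R) `stub_isogReach` (the PEL family through
  the anchor reaching a `K`-isogenous model; no decl in the tree yet) and (M) `stub_mulPow`
  (`[m]^* = mᵏ` on `Hᵏ`; consequence of the named fact `Motives.abelianVarietyCohomologyExteriorH1`);
  in the skeleton `stub_moduliReach := stub_moduliReachGlue stub_isogReach stub_mulPow`.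
-/

noncomputable section

-- single-problem summit (Problem = Summit): the mandated namespace repeats `HodgeConjecture`.
set_option linter.dupNamespace false

open CategoryTheory Complex AlgebraicGeometry
open Literature.AlgebraicGeometry Literature.AlgebraicGeometry.Motives
  Literature.AlgebraicGeometry.HodgeTheory Literature.AlgebraicTopology.SingularHomology
open Summit.HodgeConjecture.HodgeConjecture.Cruxes.HodgeAbelianVarieties.SubtorusGalleryBlochSeeds.Stubs

namespace Summit.HodgeConjecture.HodgeConjecture.Theorems.HeckePrymWeil

/-! ### `K`-equivariant pull-backs preserve the single-operator Weil span -/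

/-- **`K`-equivariant pull-backs preserve the eigenspaces of `(𝟙 + φ)^*`** (route typing): for
`g : B ⟶ A` with `g ≫ φ = ψ ≫ g` and `(𝟙+φ)^* c = μ c`, `(𝟙+ψ)^* g^* c = ((𝟙+ψ) ≫ g)^* c =
(g ≫ (𝟙+φ))^* c = μ g^* c` (van Geemen 3.6). [cite: vanGeemen1994HodgeAV, 3.6] -/
theorem map_mem_eigenspace_one_add_of_comm {A B : AbelianVariety ℂ} {φ : A ⟶ A} {ψ : B ⟶ B}
    (g : B ⟶ A) (hg : g ≫ φ = ψ ≫ g) {k : ℕ} {μ : ℂ} {c : complexBetti A.X k}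
    (hc : c ∈ Module.End.eigenspace (complexBetti.map (𝟙 A + φ).hom.hom.hom k).hom μ) :
    complexBetti.map g.hom.hom.hom k c ∈
      Module.End.eigenspace (complexBetti.map (𝟙 B + ψ).hom.hom.hom k).hom μ := by
  rw [Module.End.mem_eigenspace_iff] at hc ⊢
  have hcomm : (𝟙 B + ψ) ≫ g = g ≫ (𝟙 A + φ) := by
    simp [Preadditive.add_comp, Preadditive.comp_add, hg]
  change singularCohomology.map ℂ ℂ _ k (singularCohomology.map ℂ ℂ _ k c) = _
  rw [abelianVarietyHom_map_map_apply, hcomm, ← abelianVarietyHom_map_map_apply]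
  change complexBetti.map g.hom.hom.hom k ((complexBetti.map (𝟙 A + φ).hom.hom.hom k).hom c) = _
  rw [hc, map_smul]

/-- **`K`-equivariant pull-backs preserve the single-operator Weil span** `Eig((𝟙+φ)^*, a) ⊔
Eig((𝟙+φ)^*, b)`. [cite: vanGeemen1994HodgeAV, 3.6] -/
theorem map_mem_weilSpan_of_comm {A B : AbelianVariety ℂ} {φ : A ⟶ A} {ψ : B ⟶ B}
    (g : B ⟶ A) (hg : g ≫ φ = ψ ≫ g) {k : ℕ} {a b : ℂ} {c : complexBetti A.X k}
    (hc : c ∈ Module.End.eigenspace (complexBetti.map (𝟙 A + φ).hom.hom.hom k).hom a ⊔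
      Module.End.eigenspace (complexBetti.map (𝟙 A + φ).hom.hom.hom k).hom b) :
    complexBetti.map g.hom.hom.hom k c ∈
      Module.End.eigenspace (complexBetti.map (𝟙 B + ψ).hom.hom.hom k).hom a ⊔
        Module.End.eigenspace (complexBetti.map (𝟙 B + ψ).hom.hom.hom k).hom b := by
  rw [Submodule.mem_sup] at hc ⊢
  obtain ⟨c₁, h₁, c₂, h₂, rfl⟩ := hc
  exact ⟨_, map_mem_eigenspace_one_add_of_comm g hg h₁, _,
    map_mem_eigenspace_one_add_of_comm g hg h₂, (map_add _ _ _).symm⟩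

/-- The underlying `ℂ`-scheme morphism of an isomorphism of abelian varieties is an isomorphism. -/
theorem isIso_hom_of_iso {X Y : AbelianVariety ℂ} (e : X ≅ Y) : IsIso e.hom.hom.hom.hom :=
  ⟨⟨e.inv.hom.hom.hom,
    by change (e.hom ≫ e.inv).hom.hom.hom = _; rw [e.hom_inv_id]; rfl,
    by change (e.inv ≫ e.hom).hom.hom.hom = _; rw [e.inv_hom_id]; rfl⟩⟩

/-- `e^* (e⁻¹)^* c = c` for an isomorphism `e : X ≅ Y` of abelian varieties. -/
theorem map_hom_map_inv_apply_of_iso {X Y : AbelianVariety ℂ} (e : X ≅ Y) (k : ℕ)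
    (c : complexBetti X.X k) :
    complexBetti.map e.hom.hom.hom.hom k (complexBetti.map e.inv.hom.hom.hom k c) = c := by
  change singularCohomology.map ℂ ℂ _ k (singularCohomology.map ℂ ℂ _ k c) = _
  rw [abelianVarietyHom_map_map_apply, e.hom_inv_id]
  exact abelianVariety_map_id_apply c

/-! ### S2 on the anchor: the constant-family instance of S1 -/

section Anchor

open MonoidalCategory

/-- **S2 ON THE ANCHOR.** Let `(A₀, ψ₀, h₀)` be a complex abelian twelvefold with an endomorphism
and a rational Kähler class THROUGH WHICH WEIL CLASSES SPREAD (the `∀`-clause of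
`stub_secantSpread`, verbatim). Then every rational `(6,6)`-class of the single-operator Weil span
of `(A₀, ψ₀)` is algebraic: apply the spreading clause to the CONSTANT family `A₀ ⟶ Spec ℂ`
(a smooth projective family of relative dimension `12` over the smooth integral projective point,
every fibre inclusion an isomorphism), with the flat sections `s ↦ h₀|`, `s ↦ c|` (global classes
give continuous sections of the étalé space, `continuous_globalSection`; a Kähler class is of type
`(1,1)`, `IsKaehlerClass.isOfHodgeType_one_one`), and transport back along the fibre inclusion. -/
theorem weilSpan_mem_algebraicClasses_of_spread (A₀ : AbelianVariety ℂ) (ψ₀ : A₀ ⟶ A₀)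
    (h₀ : complexBetti A₀.X 2) (hdim : A₀.dim = 12) (hrat : IsRationalClass h₀)
    (hK : IsKaehlerClass 12 A₀.X h₀)
    (hspread : ∀ (𝒳 S : SchemeOver ℂ) (π : 𝒳 ⟶ S),
        IsSmoothProjectiveFamily π 12 → IsQuasiProjectiveOver S →
        _root_.AlgebraicGeometry.IsIntegral S.left → _root_.AlgebraicGeometry.Smooth S.hom →
      ∀ (hh : ∀ s : ComplexPoints S, complexBetti (fiberOver π s) (2 * 1))
        (w : ∀ s : ComplexPoints S, complexBetti (fiberOver π s) (2 * 6)),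
        Continuous (fun s => (⟨s, hh s⟩ : FiberClass π (2 * 1))) →
        Continuous (fun s => (⟨s, w s⟩ : FiberClass π (2 * 6))) →
        (∀ s, (⟨s, hh s⟩ : FiberClass π (2 * 1)) ∈ locusOfHodgeClasses π 12 1) →
        (∀ s, (⟨s, w s⟩ : FiberClass π (2 * 6)) ∈ locusOfHodgeClasses π 12 6) →
      ∀ (s₀ : ComplexPoints S) (ι₀ : fiberOver π s₀ ≅ A₀.X) (c₀ : complexBetti A₀.X 12),
        c₀ ∈ Module.End.eigenspace (complexBetti.map (𝟙 A₀ + ψ₀).hom.hom.hom 12).hom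
                ((1 + Complex.I * (Real.sqrt (11 : ℝ) : ℂ)) ^ 12) ⊔
              Module.End.eigenspace (complexBetti.map (𝟙 A₀ + ψ₀).hom.hom.hom 12).hom
                ((1 - Complex.I * (Real.sqrt (11 : ℝ) : ℂ)) ^ 12) →
        hh s₀ = complexBetti.map ι₀.hom (2 * 1) h₀ →
        w s₀ = complexBetti.map ι₀.hom (2 * 6) c₀ →
      ∀ s : ComplexPoints S, w s ∈ algebraicClasses (fiberOver π s) 6)
    (c : complexBetti A₀.X 12) (hc : IsRationalClass c) (hcH : IsOfHodgeType 12 A₀.X 12 6 6 c)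
    (hcW : c ∈ Module.End.eigenspace (complexBetti.map (𝟙 A₀ + ψ₀).hom.hom.hom 12).hom
                ((1 + Complex.I * (Real.sqrt (11 : ℝ) : ℂ)) ^ 12) ⊔
              Module.End.eigenspace (complexBetti.map (𝟙 A₀ + ψ₀).hom.hom.hom 12).hom
                ((1 - Complex.I * (Real.sqrt (11 : ℝ) : ℂ)) ^ 12)) :
    c ∈ algebraicClasses A₀.X 6 := by
  -- the constant family `A₀ ⟶ Spec ℂ`
  have hfam : IsSmoothProjectiveFamily (CartesianMonoidalCategory.toUnit A₀.X) 12 :=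
    hdim ▸ isSmoothProjectiveFamily_toUnit A₀
  have hint : _root_.AlgebraicGeometry.IsIntegral (𝟙_ (SchemeOver ℂ)).left :=
    inferInstanceAs (_root_.AlgebraicGeometry.IsIntegral (Spec (.of ℂ)))
  haveI hiso : ∀ u, IsIso (fiberι (CartesianMonoidalCategory.toUnit A₀.X) u) :=
    isIso_fiberι_toUnit A₀
  let s₀ : ComplexPoints (𝟙_ (SchemeOver ℂ)) := CartesianMonoidalCategory.toUnit _
  let ι₀ : fiberOver (CartesianMonoidalCategory.toUnit A₀.X) s₀ ≅ A₀.X :=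
    asIso (fiberι (CartesianMonoidalCategory.toUnit A₀.X) s₀)
  have hloc₁ : ∀ s, (⟨s, complexBetti.map (fiberι (CartesianMonoidalCategory.toUnit A₀.X) s)
      (2 * 1) h₀⟩ : FiberClass (CartesianMonoidalCategory.toUnit A₀.X) (2 * 1)) ∈
        locusOfHodgeClasses (CartesianMonoidalCategory.toUnit A₀.X) 12 1 := fun s =>
    ⟨hrat.pullback _, hK.isOfHodgeType_one_one.map_of_iso
      (asIso (fiberι (CartesianMonoidalCategory.toUnit A₀.X) s))⟩
  have hloc₆ : ∀ s, (⟨s, complexBetti.map (fiberι (CartesianMonoidalCategory.toUnit A₀.X) s)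
      (2 * 6) c⟩ : FiberClass (CartesianMonoidalCategory.toUnit A₀.X) (2 * 6)) ∈
        locusOfHodgeClasses (CartesianMonoidalCategory.toUnit A₀.X) 12 6 := fun s =>
    ⟨hc.pullback _, hcH.map_of_iso (asIso (fiberι (CartesianMonoidalCategory.toUnit A₀.X) s))⟩
  have key := hspread A₀.X (𝟙_ (SchemeOver ℂ)) (CartesianMonoidalCategory.toUnit A₀.X) hfam
    unit_base.1 hint unit_base.2.1
    (fun s => complexBetti.map (fiberι (CartesianMonoidalCategory.toUnit A₀.X) s) (2 * 1) h₀)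
    (fun s => complexBetti.map (fiberι (CartesianMonoidalCategory.toUnit A₀.X) s) (2 * 6) c)
    (continuous_globalSection _ (2 * 1) h₀) (continuous_globalSection _ (2 * 6) c) hloc₁ hloc₆
    s₀ ι₀ c hcW rfl rfl s₀
  -- transport back along the fibre inclusion (an isomorphism)
  have h2 := map_mem_algebraicClasses_of_iso ι₀.symm key
  have h3 : complexBetti.map ι₀.symm.hom (2 * 6)
      (complexBetti.map (fiberι (CartesianMonoidalCategory.toUnit A₀.X) s₀) (2 * 6) c) = c :=
    map_hom_map_inv_apply ι₀.symm (2 * 6) c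
  rw [h3] at h2
  exact h2

/-- **S2 on the `K`-isomorphism class of the anchor.** Under the hypotheses of
`weilSpan_mem_algebraicClasses_of_spread`, for every `(X, ψ)` and every isomorphism of abelian
varieties `e : X ≅ A₀` with `e ≫ ψ₀ = ψ ≫ e`, every rational `(6,6)`-class of the single-operator
Weil span of `(X, ψ)` is algebraic: `(e⁻¹)^* c` is rational, of type `(6,6)`
(`IsOfHodgeType.map_of_iso`) and in the span of `(A₀, ψ₀)` (`map_mem_weilSpan_of_comm`), hence
algebraic on `A₀`; pull back along `e` (`map_mem_algebraicClasses_of_iso`). -/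
theorem weilSpan_mem_algebraicClasses_of_spread_of_iso (A₀ : AbelianVariety ℂ) (ψ₀ : A₀ ⟶ A₀)
    (h₀ : complexBetti A₀.X 2) (hdim : A₀.dim = 12) (hrat : IsRationalClass h₀)
    (hK : IsKaehlerClass 12 A₀.X h₀)
    (hspread : ∀ (𝒳 S : SchemeOver ℂ) (π : 𝒳 ⟶ S),
        IsSmoothProjectiveFamily π 12 → IsQuasiProjectiveOver S →
        _root_.AlgebraicGeometry.IsIntegral S.left → _root_.AlgebraicGeometry.Smooth S.hom →
      ∀ (hh : ∀ s : ComplexPoints S, complexBetti (fiberOver π s) (2 * 1))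
        (w : ∀ s : ComplexPoints S, complexBetti (fiberOver π s) (2 * 6)),
        Continuous (fun s => (⟨s, hh s⟩ : FiberClass π (2 * 1))) →
        Continuous (fun s => (⟨s, w s⟩ : FiberClass π (2 * 6))) →
        (∀ s, (⟨s, hh s⟩ : FiberClass π (2 * 1)) ∈ locusOfHodgeClasses π 12 1) →
        (∀ s, (⟨s, w s⟩ : FiberClass π (2 * 6)) ∈ locusOfHodgeClasses π 12 6) →
      ∀ (s₀ : ComplexPoints S) (ι₀ : fiberOver π s₀ ≅ A₀.X) (c₀ : complexBetti A₀.X 12),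
        c₀ ∈ Module.End.eigenspace (complexBetti.map (𝟙 A₀ + ψ₀).hom.hom.hom 12).hom
                ((1 + Complex.I * (Real.sqrt (11 : ℝ) : ℂ)) ^ 12) ⊔
              Module.End.eigenspace (complexBetti.map (𝟙 A₀ + ψ₀).hom.hom.hom 12).hom
                ((1 - Complex.I * (Real.sqrt (11 : ℝ) : ℂ)) ^ 12) →
        hh s₀ = complexBetti.map ι₀.hom (2 * 1) h₀ →
        w s₀ = complexBetti.map ι₀.hom (2 * 6) c₀ →
      ∀ s : ComplexPoints S, w s ∈ algebraicClasses (fiberOver π s) 6)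
    (X : AbelianVariety ℂ) (ψ : X ⟶ X) (e : X ≅ A₀) (he : e.hom ≫ ψ₀ = ψ ≫ e.hom)
    (c : complexBetti X.X 12) (hc : IsRationalClass c) (hcH : IsOfHodgeType 12 X.X 12 6 6 c)
    (hcW : c ∈ Module.End.eigenspace (complexBetti.map (𝟙 X + ψ).hom.hom.hom 12).hom
                ((1 + Complex.I * (Real.sqrt (11 : ℝ) : ℂ)) ^ 12) ⊔
              Module.End.eigenspace (complexBetti.map (𝟙 X + ψ).hom.hom.hom 12).hom
                ((1 - Complex.I * (Real.sqrt (11 : ℝ) : ℂ)) ^ 12)) :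
    c ∈ algebraicClasses X.X 6 := by
  have hg : e.inv ≫ ψ = ψ₀ ≫ e.inv := by
    rw [Iso.inv_comp_eq, ← Category.assoc, he, Category.assoc, e.hom_inv_id, Category.comp_id]
  haveI : IsIso e.hom.hom.hom.hom := isIso_hom_of_iso e
  haveI : IsIso e.inv.hom.hom.hom := isIso_hom_of_iso e.symm
  -- the class `(e⁻¹)^* c` on the anchor
  have hc' : IsRationalClass (complexBetti.map e.inv.hom.hom.hom 12 c) := hc.pullback _
  have hc'H : IsOfHodgeType 12 A₀.X 12 6 6 (complexBetti.map e.inv.hom.hom.hom 12 c) :=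
    hcH.map_of_iso (asIso e.inv.hom.hom.hom)
  have hc'W := map_mem_weilSpan_of_comm e.inv hg hcW
  have halg := weilSpan_mem_algebraicClasses_of_spread A₀ ψ₀ h₀ hdim hrat hK hspread _ hc' hc'H hc'W
  have h2 := map_mem_algebraicClasses_of_iso (asIso e.hom.hom.hom.hom) halg
  have h3 : complexBetti.map (asIso e.hom.hom.hom.hom).hom (2 * 6)
      (complexBetti.map e.inv.hom.hom.hom 12 c) = c := map_hom_map_inv_apply_of_iso e 12 c
  rw [h3] at h2
  exact h2
end Anchor

/-! ### Packaged against the registered S1 -/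
section Packaged

/- The statement of the line's stub `stub_secantSpread` (S1), as a section hypothesis mentioned only
inside `type_of%` (so it is NOT an extra argument of the theorems below). -/
variable (stub_secantSpread :
    ∃ (A₀ : AbelianVariety ℂ) (ψ₀ e₀ : A₀ ⟶ A₀) (h₀ : complexBetti A₀.X 2),
      A₀.dim = 12 ∧ ψ₀ ≫ ψ₀ = -((11 : ℤ) • 𝟙 A₀) ∧
      e₀ ≫ e₀ = e₀ ∧ e₀ ≫ ψ₀ ≫ e₀ = 0 ∧ (𝟙 A₀ - e₀) ≫ ψ₀ ≫ (𝟙 A₀ - e₀) = 0 ∧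
      IsRationalClass h₀ ∧ h₀ ∈ algebraicClasses A₀.X 1 ∧
      complexBetti.map ψ₀.hom.hom.hom 2 h₀ = (11 : ℂ) • h₀ ∧
      (∀ x : complexBetti A₀.X 1,
        (∀ y : complexBetti A₀.X 1, polarizationPairingOne A₀.X h₀ 11 x y = 0) → x = 0) ∧
      IsKaehlerClass 12 A₀.X h₀ ∧ IsHyperbolicWeilType A₀ ψ₀ 6 h₀ ∧
      ∀ (𝒳 S : SchemeOver ℂ) (π : 𝒳 ⟶ S),
        IsSmoothProjectiveFamily π 12 → IsQuasiProjectiveOver S →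
        _root_.AlgebraicGeometry.IsIntegral S.left → _root_.AlgebraicGeometry.Smooth S.hom →
      ∀ (hh : ∀ s : ComplexPoints S, complexBetti (fiberOver π s) (2 * 1))
        (w : ∀ s : ComplexPoints S, complexBetti (fiberOver π s) (2 * 6)),
        Continuous (fun s => (⟨s, hh s⟩ : FiberClass π (2 * 1))) →
        Continuous (fun s => (⟨s, w s⟩ : FiberClass π (2 * 6))) →
        (∀ s, (⟨s, hh s⟩ : FiberClass π (2 * 1)) ∈ locusOfHodgeClasses π 12 1) →
        (∀ s, (⟨s, w s⟩ : FiberClass π (2 * 6)) ∈ locusOfHodgeClasses π 12 6) →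
      ∀ (s₀ : ComplexPoints S) (ι₀ : fiberOver π s₀ ≅ A₀.X) (c₀ : complexBetti A₀.X 12),
        c₀ ∈ Module.End.eigenspace (complexBetti.map (𝟙 A₀ + ψ₀).hom.hom.hom 12).hom
                ((1 + Complex.I * (Real.sqrt (11 : ℝ) : ℂ)) ^ 12) ⊔
              Module.End.eigenspace (complexBetti.map (𝟙 A₀ + ψ₀).hom.hom.hom 12).hom
                ((1 - Complex.I * (Real.sqrt (11 : ℝ) : ℂ)) ^ 12) →
        hh s₀ = complexBetti.map ι₀.hom (2 * 1) h₀ →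
        w s₀ = complexBetti.map ι₀.hom (2 * 6) c₀ →
      ∀ s : ComplexPoints S, w s ∈ algebraicClasses (fiberOver π s) 6)

/-- **S1 ⟹ S2 on the `K`-isomorphism class of the anchor** (the part of `stub_moduliReach` that
the tree's carriers support today: the constant family is the only family through `A₀` one can
construct). GIVEN S1, there is a hyperbolic `K`-compatibly Kähler-polarised split
`ℚ(√-11)`-twelvefold `(A₀, ψ₀, h₀)` such that on every `(X, ψ)` `K`-equivariantly isomorphic to
`(A₀, ψ₀)` the rational `(6,6)`-classes of the single-operator Weil span are algebraic. -/
theorem secantSpread_imp_moduliReach_isoClass :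
    (type_of% stub_secantSpread) →
    ∃ (A₀ : AbelianVariety ℂ) (ψ₀ e₀ : A₀ ⟶ A₀) (h₀ : complexBetti A₀.X 2),
      A₀.dim = 12 ∧ ψ₀ ≫ ψ₀ = -((11 : ℤ) • 𝟙 A₀) ∧
      e₀ ≫ e₀ = e₀ ∧ e₀ ≫ ψ₀ ≫ e₀ = 0 ∧ (𝟙 A₀ - e₀) ≫ ψ₀ ≫ (𝟙 A₀ - e₀) = 0 ∧
      IsRationalClass h₀ ∧ h₀ ∈ algebraicClasses A₀.X 1 ∧
      complexBetti.map ψ₀.hom.hom.hom 2 h₀ = (11 : ℂ) • h₀ ∧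
      (∀ x : complexBetti A₀.X 1,
        (∀ y : complexBetti A₀.X 1, polarizationPairingOne A₀.X h₀ 11 x y = 0) → x = 0) ∧
      IsKaehlerClass 12 A₀.X h₀ ∧ IsHyperbolicWeilType A₀ ψ₀ 6 h₀ ∧
      ∀ (X : AbelianVariety ℂ) (ψ : X ⟶ X) (e : X ≅ A₀), e.hom ≫ ψ₀ = ψ ≫ e.hom →
      ∀ c : complexBetti X.X 12, IsRationalClass c → IsOfHodgeType 12 X.X 12 6 6 c →
        c ∈ Module.End.eigenspace (complexBetti.map (𝟙 X + ψ).hom.hom.hom 12).hom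
              ((1 + Complex.I * (Real.sqrt (11 : ℝ) : ℂ)) ^ 12) ⊔
            Module.End.eigenspace (complexBetti.map (𝟙 X + ψ).hom.hom.hom 12).hom
              ((1 - Complex.I * (Real.sqrt (11 : ℝ) : ℂ)) ^ 12) →
        c ∈ algebraicClasses X.X 6 := by
  rintro ⟨A₀, ψ₀, e₀, h₀, hdim, hψ, he1, he2, he3, hrat, hN1, hcompat, hnd, hK, hhyp, hspread⟩
  exact ⟨A₀, ψ₀, e₀, h₀, hdim, hψ, he1, he2, he3, hrat, hN1, hcompat, hnd, hK, hhyp,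
    fun X ψ e he c hc hcH hcW =>
      weilSpan_mem_algebraicClasses_of_spread_of_iso A₀ ψ₀ h₀ hdim hrat hK hspread X ψ e he c hc
        hcH hcW⟩

/-! ### The honest remainder: S2 verbatim from S1, the PEL reach (R) and `[m]^* = mᵏ` (M) -/

/- (R) `IsogReach` — THE MISSING MODULI-THEORETIC INPUT on the real carriers (HYPOTHESIS, not
asserted; no declaration of the tree provides it). For every anchor `(A₀, ψ₀, h₀)` and every
`(X, ψ, h)` as in S2 and every rational `(6,6)`-class `c` of the Weil span of `(X, ψ)`: a smooth
projective family `π : 𝒳 ⟶ S` of relative dimension `12` over a smooth integral quasi-projective base,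
flat sections `hh`, `w` valued in the loci of Hodge classes, `s₀` with `𝒳_{s₀} ≅ A₀`, `hh(s₀) = h₀|`,
`w(s₀)` in the anchor's span, and `t` whose fibre is an abelian variety `X'` with an isogeny pair
`f : X ⟶ X'` (flat), `g : X' ⟶ X`, `f ≫ g = m • 𝟙 X`, `m ≥ 1`, and `w(t) = g^* c` under `𝒳_t ≅ X'`.
In print: Landherr (all hyperbolic rank-12 `K`-Hermitian spaces are similar, van Geemen 5.4 (5.4.1),
Deligne 1982 Cor. 4.2) + the PEL Shimura family of `U(H₁(A₀, ℤ), E_{h₀})` with neat level (smooth,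
quasi-projective, connected; fibres `A₀` at `s₀`, `X' = (H₁(A₀,ℤ), x_X)` at `t`), `hh = c₁` of the
relative polarisation, `w` = flat continuation of `g^* c` in `⋀¹²_K R¹π_*ℚ` (trivial monodromy on a
finite étale cover), rational `(6,6)` everywhere (van Geemen §5; Mumford GIT Thm. 7.9). -/
variable (stub_isogReach :
    ∀ (A₀ : AbelianVariety ℂ) (ψ₀ : A₀ ⟶ A₀) (h₀ : complexBetti A₀.X 2),
      A₀.dim = 12 → ψ₀ ≫ ψ₀ = -((11 : ℤ) • 𝟙 A₀) → IsRationalClass h₀ →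
      h₀ ∈ algebraicClasses A₀.X 1 → complexBetti.map ψ₀.hom.hom.hom 2 h₀ = (11 : ℂ) • h₀ →
      (∀ x : complexBetti A₀.X 1,
        (∀ y : complexBetti A₀.X 1, polarizationPairingOne A₀.X h₀ 11 x y = 0) → x = 0) →
      IsKaehlerClass 12 A₀.X h₀ → IsHyperbolicWeilType A₀ ψ₀ 6 h₀ →
    ∀ (X : AbelianVariety ℂ) (ψ : X ⟶ X), X.dim = 12 → ψ ≫ ψ = -((11 : ℤ) • 𝟙 X) →
    ∀ h : complexBetti X.X 2, IsRationalClass h → h ∈ algebraicClasses X.X 1 →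
      complexBetti.map ψ.hom.hom.hom 2 h = (11 : ℂ) • h →
      (∀ x : complexBetti X.X 1,
        (∀ y : complexBetti X.X 1, polarizationPairingOne X.X h 11 x y = 0) → x = 0) →
      IsKaehlerClass 12 X.X h → IsHyperbolicWeilType X ψ 6 h →
    ∀ c : complexBetti X.X 12, IsRationalClass c → IsOfHodgeType 12 X.X 12 6 6 c →
      c ∈ Module.End.eigenspace (complexBetti.map (𝟙 X + ψ).hom.hom.hom 12).hom
            ((1 + Complex.I * (Real.sqrt (11 : ℝ) : ℂ)) ^ 12) ⊔
          Module.End.eigenspace (complexBetti.map (𝟙 X + ψ).hom.hom.hom 12).hom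
            ((1 - Complex.I * (Real.sqrt (11 : ℝ) : ℂ)) ^ 12) →
    ∃ (𝒳 S : SchemeOver ℂ) (π : 𝒳 ⟶ S)
      (hh : ∀ s : ComplexPoints S, complexBetti (fiberOver π s) (2 * 1))
      (w : ∀ s : ComplexPoints S, complexBetti (fiberOver π s) (2 * 6))
      (s₀ t : ComplexPoints S) (ι₀ : fiberOver π s₀ ≅ A₀.X) (c₀ : complexBetti A₀.X 12)
      (X' : AbelianVariety ℂ) (f : X ⟶ X') (g : X' ⟶ X) (m : ℕ) (ι : fiberOver π t ≅ X'.X),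
      IsSmoothProjectiveFamily π 12 ∧ IsQuasiProjectiveOver S ∧
      _root_.AlgebraicGeometry.IsIntegral S.left ∧ _root_.AlgebraicGeometry.Smooth S.hom ∧
      Continuous (fun s => (⟨s, hh s⟩ : FiberClass π (2 * 1))) ∧
      Continuous (fun s => (⟨s, w s⟩ : FiberClass π (2 * 6))) ∧
      (∀ s, (⟨s, hh s⟩ : FiberClass π (2 * 1)) ∈ locusOfHodgeClasses π 12 1) ∧
      (∀ s, (⟨s, w s⟩ : FiberClass π (2 * 6)) ∈ locusOfHodgeClasses π 12 6) ∧
      c₀ ∈ Module.End.eigenspace (complexBetti.map (𝟙 A₀ + ψ₀).hom.hom.hom 12).hom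
              ((1 + Complex.I * (Real.sqrt (11 : ℝ) : ℂ)) ^ 12) ⊔
            Module.End.eigenspace (complexBetti.map (𝟙 A₀ + ψ₀).hom.hom.hom 12).hom
              ((1 - Complex.I * (Real.sqrt (11 : ℝ) : ℂ)) ^ 12) ∧
      hh s₀ = complexBetti.map ι₀.hom (2 * 1) h₀ ∧ w s₀ = complexBetti.map ι₀.hom (2 * 6) c₀ ∧
      0 < m ∧ f ≫ g = m • 𝟙 X ∧ Flat f.hom.hom.hom.left ∧
      w t = complexBetti.map ι.hom (2 * 6) (complexBetti.map g.hom.hom.hom 12 c))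

/- (M) `MulPow` — multiplication by `m` acts as `mᵏ` on `Hᵏ(Y(ℂ); ℂ)` of a complex abelian variety
(HYPOTHESIS; Mumford, *Abelian Varieties* §1 (3) and §19; Milne 1986 Thm. 8.2 / 15.1:
`H^k = ⋀^k H¹`, `[m]^* = m` on `H¹`). In the tree: a consequence of the named fact
`Motives.abelianVarietyCohomologyExteriorH1` with the PROVED additivity
`complexBetti_map_nsmul_id_add_nsmul_one`; on the simultaneous-eigenclass plane `weilClassesOf` it is
the proved `map_nsmul_id_eq_of_mem_weilClassesOf`, but the route types the span with ONE operator. -/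
variable (stub_mulPow : ∀ (Y : AbelianVariety ℂ) (m k : ℕ) (y : complexBetti Y.X k),
    complexBetti.map (m • 𝟙 Y).hom.hom.hom k y = ((m : ℂ) ^ k) • y)

/-- **The registered stub S2 VERBATIM from (R), (M) and S1** — the honest shape of "γ ⟹ T₊" on the
tree's carriers: (R) supplies the PEL family through the anchor reaching a `K`-isogenous model `X'`
of `X` with the flat Weil section `w` through `g^* c`; S1 makes `w(t)` algebraic on `𝒳_t ≅ X'`
(transport along the isomorphism, `map_mem_algebraicClasses_of_iso`); the flat pull-back along `f`
(`map_mem_algebraicClasses_of_flat`) gives `f^* g^* c = (m • 𝟙 X)^* c = m¹² · c` algebraic by (M),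
and `m¹² ≠ 0` (van Geemen 3.6–3.7; Markman arXiv:2509.23403 §11.5 Step 1). Everything after the two
hypotheses is a theorem of the tree. -/
theorem stub_moduliReachGlue :
    (type_of% stub_isogReach) → (type_of% stub_mulPow) → (type_of% stub_secantSpread) →
    ∀ (X : AbelianVariety ℂ) (ψ : X ⟶ X), X.dim = 12 → ψ ≫ ψ = -((11 : ℤ) • 𝟙 X) →
    ∀ h : complexBetti X.X 2, IsRationalClass h → h ∈ algebraicClasses X.X 1 →
      complexBetti.map ψ.hom.hom.hom 2 h = (11 : ℂ) • h →
      (∀ x : complexBetti X.X 1,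
        (∀ y : complexBetti X.X 1, polarizationPairingOne X.X h 11 x y = 0) → x = 0) →
      IsKaehlerClass 12 X.X h → IsHyperbolicWeilType X ψ 6 h →
    ∀ c : complexBetti X.X 12, IsRationalClass c → IsOfHodgeType 12 X.X 12 6 6 c →
      c ∈ Module.End.eigenspace (complexBetti.map (𝟙 X + ψ).hom.hom.hom 12).hom
            ((1 + Complex.I * (Real.sqrt (11 : ℝ) : ℂ)) ^ 12) ⊔
          Module.End.eigenspace (complexBetti.map (𝟙 X + ψ).hom.hom.hom 12).hom
            ((1 - Complex.I * (Real.sqrt (11 : ℝ) : ℂ)) ^ 12) →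
      c ∈ algebraicClasses X.X 6 := by
  intro hR hM hS1 X ψ hX hψ h hhr hh1 hhc hhn hhK hhH c hc hcH hcW
  obtain ⟨A₀, ψ₀, e₀, h₀, hdim, hψ₀, -, -, -, hrat, hN1, hcompat, hnd, hK, hhyp, hspread⟩ := hS1
  obtain ⟨𝒳, S, π, hh', w, s₀, t, ι₀, c₀, X', f, g, m, ι, hfam, hqp, hint, hsm, hco1, hco6, hl1,
      hl6, hc₀, hhs₀, hws₀, hm, hfg, hflat, hwt⟩ :=
    hR A₀ ψ₀ h₀ hdim hψ₀ hrat hN1 hcompat hnd hK hhyp X ψ hX hψ h hhr hh1 hhc hhn hhK hhH c hc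
      hcH hcW
  -- S1 along the reaching family: `w(t)` is algebraic on the fibre `𝒳_t`
  have key := hspread 𝒳 S π hfam hqp hint hsm hh' w hco1 hco6 hl1 hl6 s₀ ι₀ c₀ hc₀ hhs₀ hws₀ t
  rw [hwt] at key
  -- hence `g^* c` is algebraic on `X'`
  have h1 := map_mem_algebraicClasses_of_iso ι.symm key
  have h1' : complexBetti.map ι.symm.hom (2 * 6)
      (complexBetti.map ι.hom (2 * 6) (complexBetti.map g.hom.hom.hom 12 c)) =
        complexBetti.map g.hom.hom.hom 12 c :=
    map_hom_map_inv_apply ι.symm (2 * 6) _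
  rw [h1'] at h1
  -- flat pull-back along `f`: `f^* g^* c = (m • 𝟙 X)^* c = m¹² • c` is algebraic on `X`
  haveI : Flat f.hom.hom.hom.left := hflat
  haveI : IsLocallyNoetherian X.X.left := HeckePrymWeilLine.isLocallyNoetherian_abelianVariety_left X
  haveI : IsLocallyNoetherian X'.X.left :=
    HeckePrymWeilLine.isLocallyNoetherian_abelianVariety_left X'
  have h2 := map_mem_algebraicClasses_of_flat f.hom.hom.hom h1
  have h3 : complexBetti.map f.hom.hom.hom (2 * 6) (complexBetti.map g.hom.hom.hom 12 c) =
      ((m : ℂ) ^ 12) • c := by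
    change singularCohomology.map ℂ ℂ _ 12 (singularCohomology.map ℂ ℂ _ 12 c) = _
    rw [abelianVarietyHom_map_map_apply, hfg]
    exact hM X m 12 c
  rw [h3] at h2
  have hmC : ((m : ℂ) ^ 12) ≠ 0 := pow_ne_zero _ (Nat.cast_ne_zero.mpr hm.ne')
  have h4 := Submodule.smul_mem (algebraicClasses X.X 6) (((m : ℂ) ^ 12)⁻¹) h2
  rwa [smul_smul, inv_mul_cancel₀ hmC, one_smul] at h4

end Packaged

end Summit.HodgeConjecture.HodgeConjecture.Theorems.HeckePrymWeil

end
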